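import Literature.Computability.QuantumComplexity.SlaterState
import HarnessLib

/-!
# Slater determinant states: nearest-neighbour matchgates (two-mode rotations)

Trunk `Literature/Computability/QuantumComplexity`; API for `slaterState` (`SlaterState.lean`,
definition request `defn-slaterState`, route QuantumAdvantage/FermionicMagic, support item
`CubeSeaPrep`) — all proved.

A number-preserving one-body rotation `u ∈ M₂(R)` of two modes `j, j'` acts on Slater
determinants orbital-wise (`Γ(V) ψ†(φ₀)⋯ψ†(φ_{k-1})|vac⟩ = ψ†(Vφ₀)⋯ψ†(Vφ_{k-1})|vac⟩`,
Terhal–DiVincenzo `U a†ᵢ U† = ∑ₘ V_{im} a†ₘ`). Under Jordan–Wigner, for ADJACENT modes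
`j' = j + 1` the operator `Γ(V)` is the nearest-neighbour matchgate `G(A,B)` of Jozsa–Miyake with
`A = diag(1, det u)` on `{|00⟩, |11⟩}` and `B` = `u` on the one-particle sector (basis
`|1ⱼ0ⱼ'⟩, |0ⱼ1ⱼ'⟩`), i.e. `1 ⊕ u ⊕ det u`; e.g. the Hadamard beam splitter (`u = H`), Givens
rotations, and the fermionic swap (`u = X`: `1 ⊕ X ⊕ (-1) = SWAP·CZ`). The four lemmas below are
the four blocks of this matrix, stated on amplitudes, with the rotated orbitals `φ'` described by
hypotheses (`hoff`: unchanged off `{j, j'}`; `hj`, `hj'`: the new `j`-, `j'`-components):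

* `slaterState_pair_of_false_false` — both modes empty: amplitude unchanged (any `j, j'`);
* `slaterState_pair_of_true_false`, `slaterState_pair_of_false_true` — one particle on the pair:
  the rows of `u`, the partner amplitude being that of the pattern with the particle moved
  (needs JW-adjacency: no site strictly between `j` and `j'`, so moving the particle does not
  reorder the other columns — `strictMono_update_of_val_eq_succ/pred`,
  `det_updateCol_eq_slaterState_move`);
* `slaterState_pair_of_true_true` — both occupied: factor `det u` (any `j ≠ j'`);
* `slaterState_comp_swap_adjacent` — fermionic swap of adjacent modes: exchanging the components
  `j, j+1` of the orbitals exchanges the two qubits of the pattern, with sign `-1` when both are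
  occupied.

## References

* R. Jozsa, A. Miyake, *Matchgates and classical simulation of quantum circuits*, Proc. R. Soc.
  A 464 (2008) 3089, §1 eq. (1) (`G(A,B)`: `A` on the even-parity subspace `{|00⟩,|11⟩}`, `B` on
  `{|01⟩,|10⟩}`), §5 (nearest-neighbour `G(A,B)` = Gaussian operations in the Jordan–Wigner
  representation). [JozsaMiyake2008]
* B. M. Terhal, D. P. DiVincenzo, *Classical simulation of noninteracting-fermion quantum
  circuits*, Phys. Rev. A 65 (2002) 032325, §3 (`U a†ᵢ U† = ∑ₘ V_{im} a†ₘ`). [TerhalDivincenzo2002]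

## Design choices

* Stated on amplitudes (pure determinant identities over a commutative ring), not through the
  tree's `placeGate`: a prover links a concrete placed `4 × 4` gate to these four blocks by
  `placeGate_apply`. Conventions: `u₀₀, u₀₁` are the coefficients of the new `j`-component on the
  old `(j, j')`-components, `u₁₀, u₁₁` those of the new `j'`-component.
-/

noncomputable section

open Matrix Finset

namespace Literature.Computability.QuantumComplexity

open Cryptography (QReg)

variable {R : Type*} [CommRing R] {n k : ℕ}

/-! ### Moving one particle -/

/-- Setting site `s` to empty and then site `t` to occupied (moving a particle from `s` to `t`).
[folklore] -/
theorem occupied_move (x : QReg n) (s t : Fin n) :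
    occupied (Function.update (Function.update x s false) t true) = insert t ((occupied x).erase s) := by
  ext i
  rw [mem_occupied, mem_insert, mem_erase, mem_occupied, Function.update_apply, Function.update_apply]
  by_cases hit : i = t
  · simp [hit]
  · by_cases his : i = s
    · simp [his]
    · simp [hit, his]

/-- Moving a particle preserves the particle number. [folklore] -/
theorem card_occupied_move {x : QReg n} {s t : Fin n} (hs : x s = true) (ht : x t = false) :
    (occupied (Function.update (Function.update x s false) t true)).card = (occupied x).card := by
  have hts : t ∉ (occupied x).erase s := by simp [ht]
  have hpos : 0 < (occupied x).card := card_pos.2 ⟨s, mem_occupied.2 hs⟩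
  rw [occupied_move x s t, card_insert_of_notMem hts, card_erase_of_mem (mem_occupied.2 hs)]
  omega

/-! ### Two-mode rotations on Jordan–Wigner-adjacent modes (nearest-neighbour matchgates) -/

/-- Replacing `j` by `j+1` in an increasing enumeration containing `j` but not `j+1` keeps it
increasing (no site lies strictly between). [folklore] -/
theorem strictMono_update_of_val_eq_succ {e : Fin k → Fin n} (he : StrictMono e) {p : Fin k}
    {j j' : Fin n} (hp : e p = j) (hjj' : (j' : ℕ) = j + 1) (hj' : ∀ b, e b ≠ j') :
    StrictMono (Function.update e p j') := by
  intro b₁ b₂ hlt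
  rcases eq_or_ne b₁ p with rfl | h₁
  · rw [Function.update_self, Function.update_of_ne (ne_of_gt hlt)]
    have h1 : j < e b₂ := hp ▸ he hlt
    have h2 : (e b₂ : ℕ) ≠ j' := fun h => hj' b₂ (Fin.ext h)
    rw [Fin.lt_def] at h1 ⊢
    omega
  · rw [Function.update_of_ne h₁]
    rcases eq_or_ne b₂ p with rfl | h₂
    · rw [Function.update_self]
      have h1 : e b₁ < j := hp ▸ he hlt
      rw [Fin.lt_def] at h1 ⊢
      omega
    · rw [Function.update_of_ne h₂]
      exact he hlt

/-- Replacing `j+1` by `j` in an increasing enumeration containing `j+1` but not `j` keeps it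
increasing. [folklore] -/
theorem strictMono_update_of_val_eq_pred {e : Fin k → Fin n} (he : StrictMono e) {p : Fin k}
    {j j' : Fin n} (hp : e p = j') (hjj' : (j' : ℕ) = j + 1) (hj : ∀ b, e b ≠ j) :
    StrictMono (Function.update e p j) := by
  intro b₁ b₂ hlt
  rcases eq_or_ne b₁ p with rfl | h₁
  · rw [Function.update_self, Function.update_of_ne (ne_of_gt hlt)]
    have h1 : j' < e b₂ := hp ▸ he hlt
    rw [Fin.lt_def] at h1 ⊢
    omega
  · rw [Function.update_of_ne h₁]
    rcases eq_or_ne b₂ p with rfl | h₂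
    · rw [Function.update_self]
      have h1 : e b₁ < j' := hp ▸ he hlt
      have h2 : (e b₁ : ℕ) ≠ j := fun h => hj b₁ (Fin.ext h)
      rw [Fin.lt_def] at h1 ⊢
      omega
    · rw [Function.update_of_ne h₂]
      exact he hlt

/-- **Moving one particle.** If site `s` of `x` is occupied (column `p`) and site `t` is empty,
and replacing `s` by `t` in the increasing enumeration keeps it increasing, then the minor with
column `p` replaced by the `t`-column of the orbitals is the amplitude on the moved pattern.
[folklore] -/
theorem det_updateCol_eq_slaterState_move (φ : Fin k → Fin n → R) {x : QReg n}
    (h : (occupied x).card = k) (p : Fin k) {s t : Fin n} (hp : (occupied x).orderEmbOfFin h p = s)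
    (ht : x t = false) (hmono : StrictMono (Function.update ⇑((occupied x).orderEmbOfFin h) p t)) :
    (updateCol ((Matrix.of φ).submatrix id ((occupied x).orderEmbOfFin h)) p fun a => φ a t).det =
      slaterState φ (Function.update (Function.update x s false) t true) := by
  set e := (occupied x).orderEmbOfFin h with he_def
  have hs : x s = true := hp ▸ occupied_orderEmbOfFin_apply_eq_true h p
  have hy' : (occupied (Function.update (Function.update x s false) t true)).card = k := by
    rw [card_occupied_move hs ht, h]
  have hey : Function.update ⇑e p t =
      ⇑((occupied (Function.update (Function.update x s false) t true)).orderEmbOfFin hy') := by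
    refine orderEmbOfFin_unique hy' (fun b => ?_) hmono
    rw [occupied_move x s t]
    rcases eq_or_ne b p with rfl | hb
    · rw [Function.update_self]
      exact mem_insert_self _ _
    · rw [Function.update_of_ne hb]
      exact mem_insert_of_mem (mem_erase.2
        ⟨fun heq => hb (e.injective (heq.trans hp.symm)), orderEmbOfFin_mem _ h b⟩)
  rw [slaterState_of_card_eq _ hy']
  congr 1
  ext a b
  rw [updateCol_apply]
  simp only [submatrix_apply, id_eq, of_apply, ← hey, Function.update_apply]
  split_ifs <;> rfl

/-- **Both modes empty**: a two-mode rotation of the orbitals on sites `j, j'` does not change the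
amplitude on patterns with `j, j'` empty (the block `1` of `1 ⊕ u ⊕ det u`).
[Jozsa–Miyake 2008, §1 eq. (1), §5] [folklore] -/
theorem slaterState_pair_of_false_false {φ φ' : Fin k → Fin n → R} {j j' : Fin n}
    (hoff : ∀ a i, i ≠ j → i ≠ j' → φ' a i = φ a i) {x : QReg n} (hxj : x j = false)
    (hxj' : x j' = false) : slaterState φ' x = slaterState φ x := by
  by_cases h : (occupied x).card = k
  · rw [slaterState_of_card_eq _ h, slaterState_of_card_eq _ h]
    congr 1
    ext a b
    simp only [submatrix_apply, id_eq, of_apply]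
    have hb := occupied_orderEmbOfFin_apply_eq_true h b
    refine hoff _ _ (fun heq => ?_) (fun heq => ?_)
    · rw [heq, hxj] at hb; exact Bool.false_ne_true hb
    · rw [heq, hxj'] at hb; exact Bool.false_ne_true hb
  · rw [slaterState_of_card_ne _ h, slaterState_of_card_ne _ h]

/-- **Mode `j` occupied, `j' = j+1` empty**: the amplitude of the rotated orbitals is
`u₀₀ ·` (amplitude on `x`) `+ u₀₁ ·` (amplitude on `x` with the particle moved to `j'`) — the
first row of the block `u`. Needs JW-adjacency of `j, j'`. [Jozsa–Miyake 2008, §1 eq. (1), §5]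
[folklore] -/
theorem slaterState_pair_of_true_false {φ φ' : Fin k → Fin n → R} {j j' : Fin n}
    (hjj' : (j' : ℕ) = j + 1) {u₀₀ u₀₁ : R} (hoff : ∀ a i, i ≠ j → i ≠ j' → φ' a i = φ a i)
    (hj : ∀ a, φ' a j = u₀₀ * φ a j + u₀₁ * φ a j') {x : QReg n} (hxj : x j = true)
    (hxj' : x j' = false) :
    slaterState φ' x = u₀₀ * slaterState φ x +
      u₀₁ * slaterState φ (Function.update (Function.update x j false) j' true) := by
  by_cases h : (occupied x).card = k
  · set e := (occupied x).orderEmbOfFin h with he_def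
    obtain ⟨p, hp⟩ : j ∈ Set.range e := by
      rw [he_def, range_orderEmbOfFin, mem_coe, mem_occupied]; exact hxj
    have hj'e : ∀ b, e b ≠ j' := fun b hb => by
      have := occupied_orderEmbOfFin_apply_eq_true h b
      rw [← he_def, hb, hxj'] at this
      exact Bool.false_ne_true this
    have hmono := strictMono_update_of_val_eq_succ e.strictMono hp hjj' hj'e
    rw [slaterState_of_card_eq _ h, slaterState_of_card_eq _ h,
      ← det_updateCol_eq_slaterState_move φ h p hp hxj' hmono]
    have hM' : (Matrix.of φ').submatrix id e =
        updateCol ((Matrix.of φ).submatrix id e) p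
          (u₀₀ • (fun a => φ a j) + u₀₁ • (fun a => φ a j')) := by
      ext a b
      rw [updateCol_apply]
      simp only [submatrix_apply, id_eq, of_apply, Pi.add_apply, Pi.smul_apply, smul_eq_mul]
      by_cases hb : b = p
      · rw [if_pos hb, hb, hp, hj]
      · rw [if_neg hb]
        exact hoff _ _ (fun heq => hb (e.injective (heq.trans hp.symm))) (hj'e b)
    have hcol : (fun a => φ a j) = fun a => ((Matrix.of φ).submatrix id e) a p := by
      funext a; simp [hp]
    rw [hM', det_updateCol_add, det_updateCol_smul, det_updateCol_smul, hcol, updateCol_eq_self]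
  · have hy : (occupied (Function.update (Function.update x j false) j' true)).card ≠ k := by
      rwa [card_occupied_move hxj hxj']
    rw [slaterState_of_card_ne _ h, slaterState_of_card_ne _ h, slaterState_of_card_ne _ hy]
    ring

/-- **Mode `j` empty, `j' = j+1` occupied**: the amplitude of the rotated orbitals is
`u₁₀ ·` (amplitude on `x` with the particle moved to `j`) `+ u₁₁ ·` (amplitude on `x`) — the
second row of the block `u`. Needs JW-adjacency of `j, j'`. [Jozsa–Miyake 2008, §1 eq. (1), §5]
[folklore] -/
theorem slaterState_pair_of_false_true {φ φ' : Fin k → Fin n → R} {j j' : Fin n}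
    (hjj' : (j' : ℕ) = j + 1) {u₁₀ u₁₁ : R} (hoff : ∀ a i, i ≠ j → i ≠ j' → φ' a i = φ a i)
    (hj' : ∀ a, φ' a j' = u₁₀ * φ a j + u₁₁ * φ a j') {x : QReg n} (hxj : x j = false)
    (hxj' : x j' = true) :
    slaterState φ' x = u₁₀ * slaterState φ (Function.update (Function.update x j' false) j true) +
      u₁₁ * slaterState φ x := by
  by_cases h : (occupied x).card = k
  · set e := (occupied x).orderEmbOfFin h with he_def
    obtain ⟨p, hp⟩ : j' ∈ Set.range e := by
      rw [he_def, range_orderEmbOfFin, mem_coe, mem_occupied]; exact hxj'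
    have hje : ∀ b, e b ≠ j := fun b hb => by
      have := occupied_orderEmbOfFin_apply_eq_true h b
      rw [← he_def, hb, hxj] at this
      exact Bool.false_ne_true this
    have hmono := strictMono_update_of_val_eq_pred e.strictMono hp hjj' hje
    rw [slaterState_of_card_eq _ h, slaterState_of_card_eq _ h,
      ← det_updateCol_eq_slaterState_move φ h p hp hxj hmono]
    have hM' : (Matrix.of φ').submatrix id e =
        updateCol ((Matrix.of φ).submatrix id e) p
          (u₁₀ • (fun a => φ a j) + u₁₁ • (fun a => φ a j')) := by
      ext a b
      rw [updateCol_apply]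
      simp only [submatrix_apply, id_eq, of_apply, Pi.add_apply, Pi.smul_apply, smul_eq_mul]
      by_cases hb : b = p
      · rw [if_pos hb, hb, hp, hj']
      · rw [if_neg hb]
        exact hoff _ _ (hje b) (fun heq => hb (e.injective (heq.trans hp.symm)))
    have hcol : (fun a => φ a j') = fun a => ((Matrix.of φ).submatrix id e) a p := by
      funext a; simp [hp]
    rw [hM', det_updateCol_add, det_updateCol_smul, det_updateCol_smul, hcol, updateCol_eq_self]
  · have hy : (occupied (Function.update (Function.update x j' false) j true)).card ≠ k := by
      rwa [card_occupied_move hxj' hxj]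
    rw [slaterState_of_card_ne _ h, slaterState_of_card_ne _ h, slaterState_of_card_ne _ hy]
    ring

/-- **Both modes occupied**: a two-mode rotation `u` of the orbitals on sites `j ≠ j'` multiplies
the amplitude on patterns with both `j, j'` occupied by `det u` (the block `det u` of
`1 ⊕ u ⊕ det u`; no adjacency needed). [Jozsa–Miyake 2008, §1 eq. (1), §5] [folklore] -/
theorem slaterState_pair_of_true_true {φ φ' : Fin k → Fin n → R} {j j' : Fin n} (hne : j ≠ j')
    {u₀₀ u₀₁ u₁₀ u₁₁ : R} (hoff : ∀ a i, i ≠ j → i ≠ j' → φ' a i = φ a i)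
    (hj : ∀ a, φ' a j = u₀₀ * φ a j + u₀₁ * φ a j') (hj' : ∀ a, φ' a j' = u₁₀ * φ a j + u₁₁ * φ a j')
    {x : QReg n} (hxj : x j = true) (hxj' : x j' = true) :
    slaterState φ' x = (u₀₀ * u₁₁ - u₀₁ * u₁₀) * slaterState φ x := by
  by_cases h : (occupied x).card = k
  · set e := (occupied x).orderEmbOfFin h with he_def
    obtain ⟨p, hp⟩ : j ∈ Set.range e := by
      rw [he_def, range_orderEmbOfFin, mem_coe, mem_occupied]; exact hxj
    obtain ⟨q, hq⟩ : j' ∈ Set.range e := by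
      rw [he_def, range_orderEmbOfFin, mem_coe, mem_occupied]; exact hxj'
    have hpq : p ≠ q := fun hpq => hne (by rw [← hp, ← hq, hpq])
    rw [slaterState_of_card_eq _ h, slaterState_of_card_eq _ h]
    set M := (Matrix.of φ).submatrix id e with hM_def
    set cj : Fin k → R := fun a => φ a j with hcj_def
    set cj' : Fin k → R := fun a => φ a j' with hcj'_def
    have hMp : (fun a => M a p) = cj := by funext a; simp [hM_def, hcj_def, hp]
    have hMq : (fun a => M a q) = cj' := by funext a; simp [hM_def, hcj'_def, hq]
    have hM' : (Matrix.of φ').submatrix id e =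
        updateCol (updateCol M p (u₀₀ • cj + u₀₁ • cj')) q (u₁₀ • cj + u₁₁ • cj') := by
      ext a b
      rw [updateCol_apply, updateCol_apply]
      simp only [hM_def, submatrix_apply, id_eq, of_apply, Pi.add_apply, Pi.smul_apply,
        smul_eq_mul, hcj_def, hcj'_def]
      by_cases hbq : b = q
      · rw [if_pos hbq, hbq, hq, hj']
      · rw [if_neg hbq]
        by_cases hbp : b = p
        · rw [if_pos hbp, hbp, hp, hj]
        · rw [if_neg hbp]
          exact hoff _ _ (fun heq => hbp (e.injective (heq.trans hp.symm)))
            (fun heq => hbq (e.injective (heq.trans hq.symm)))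
    -- the four column-replaced determinants
    have D1 : ((M.updateCol q cj).updateCol p cj).det = 0 :=
      det_zero_of_column_eq hpq fun a => by
        rw [updateCol_self, updateCol_ne hpq.symm, updateCol_self]
    have D2 : ((M.updateCol q cj).updateCol p cj').det = -M.det := by
      have hN : (M.updateCol q cj).updateCol p cj' = M.submatrix id (Equiv.swap p q) := by
        ext a b
        rw [updateCol_apply, updateCol_apply, submatrix_apply, id_eq]
        by_cases hbp : b = p
        · rw [if_pos hbp, hbp, Equiv.swap_apply_left, ← hMq]
        · rw [if_neg hbp]
          by_cases hbq : b = q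
          · rw [if_pos hbq, hbq, Equiv.swap_apply_right, ← hMp]
          · rw [if_neg hbq, Equiv.swap_apply_of_ne_of_ne hbp hbq]
      rw [hN, det_permute', Equiv.Perm.sign_swap hpq]
      simp
    have D3 : ((M.updateCol q cj').updateCol p cj).det = M.det := by
      rw [← hMq, updateCol_eq_self, ← hMp, updateCol_eq_self]
    have D4 : ((M.updateCol q cj').updateCol p cj').det = 0 :=
      det_zero_of_column_eq hpq fun a => by
        rw [updateCol_self, updateCol_ne hpq.symm, updateCol_self]
    rw [hM', det_updateCol_add, det_updateCol_smul, det_updateCol_smul,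
      updateCol_comm _ hpq, det_updateCol_add, det_updateCol_smul, det_updateCol_smul, D1, D2,
      updateCol_comm _ hpq, det_updateCol_add, det_updateCol_smul, det_updateCol_smul, D3, D4]
    ring
  · rw [slaterState_of_card_ne _ h, slaterState_of_card_ne _ h, mul_zero]

/-- **Fermionic swap of adjacent modes.** Exchanging the components `j, j+1` of every orbital
(`u = X`, the matchgate `1 ⊕ X ⊕ (-1)` = `SWAP·CZ`) exchanges the two qubits of the pattern up
to the sign `-1` on patterns with both sites occupied. [Jozsa–Miyake 2008, §5] [folklore] -/
theorem slaterState_comp_swap_adjacent {j j' : Fin n} (hjj' : (j' : ℕ) = j + 1)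
    (φ : Fin k → Fin n → R) (x : QReg n) :
    slaterState (fun a i => φ a (Equiv.swap j j' i)) x =
      (if x j = true ∧ x j' = true then -1 else 1) * slaterState φ (x ∘ Equiv.swap j j') := by
  have hne : j ≠ j' := fun h => by rw [h] at hjj'; omega
  have hoff : ∀ a i, i ≠ j → i ≠ j' → φ a (Equiv.swap j j' i) = φ a i := fun a i hi hi' => by
    rw [Equiv.swap_apply_of_ne_of_ne hi hi']
  have hj : ∀ a, φ a (Equiv.swap j j' j) = 0 * φ a j + 1 * φ a j' := fun a => by
    rw [Equiv.swap_apply_left]; ring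
  have hj' : ∀ a, φ a (Equiv.swap j j' j') = 1 * φ a j + 0 * φ a j' := fun a => by
    rw [Equiv.swap_apply_right]; ring
  cases hxj : x j <;> cases hxj' : x j'
  · -- both empty
    have hx : x ∘ Equiv.swap j j' = x := by
      funext i; simp only [Function.comp_apply, Equiv.swap_apply_def]
      split_ifs <;> simp_all
    rw [slaterState_pair_of_false_false hoff hxj hxj', hx]
    simp
  · -- j empty, j' occupied
    have hx : x ∘ Equiv.swap j j' = Function.update (Function.update x j' false) j true := by
      funext i; simp only [Function.comp_apply, Equiv.swap_apply_def, Function.update_apply]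
      by_cases h1 : i = j
      · simp [h1, hxj']
      · by_cases h2 : i = j'
        · simp [h2, hne.symm, hxj]
        · simp [h1, h2]
    rw [slaterState_pair_of_false_true hjj' hoff hj' hxj hxj', hx]
    simp
  · -- j occupied, j' empty
    have hx : x ∘ Equiv.swap j j' = Function.update (Function.update x j false) j' true := by
      funext i; simp only [Function.comp_apply, Equiv.swap_apply_def, Function.update_apply]
      by_cases h1 : i = j'
      · simp [h1, hne.symm, hxj]
      · by_cases h2 : i = j
        · simp [h2, hne, hxj']
        · simp [h1, h2]
    rw [slaterState_pair_of_true_false hjj' hoff hj hxj hxj', hx]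
    simp
  · -- both occupied
    have hx : x ∘ Equiv.swap j j' = x := by
      funext i; simp only [Function.comp_apply, Equiv.swap_apply_def]
      split_ifs <;> simp_all
    rw [slaterState_pair_of_true_true hne hoff hj hj' hxj hxj', hx]
    simp

end Literature.Computability.QuantumComplexity
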